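import Literature.NumberTheory.Rogawski1990.ArchChartPartnerClasses               -- ★ P3 (LH4-p03): `card_filter_partnerPerms_mk_gprimeTorus_slotPerm_eq`, `sum_image_eq_partnerWeight_mul_sum_partnerPerms`; brings `partnerPerms ∕ slotPerm ∕ partnerWeight`
import Literature.NumberTheory.Automorphic.ArchInnerFormChartExhaustion            -- ★ (EXH-G′) ED. 2 (LH7-p01 (g2)): `forall_conjClasses_eq_mk_gprimeTorus_slotPerm`
import Literature.NumberTheory.Automorphic.ArchChartNormPairs                      -- ★ (PARTNER) P1 (LH3-p03): `isArchNormPair_endoTorus_gprimeTorus(_perm)`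
import Literature.NumberTheory.Automorphic.ArchInnerFormCartanAtlasSwap              -- ★ (LH3-p03): `swapMatrix_mul_coe_gprimeCptGL` (monomial matrices permute the compact chart's angles)
import Mathlib.MeasureTheory.Measure.Haar.Unique
import HarnessLib

/-!
# Slot permutations of the `G′` Cartan atlas: the classes inside the STABLE class of a regular chart point are the slot-permuted chart classes (UNIQ-G′), one ambient conjugator
# permutes the slots of the whole chart, and finite-order automorphisms preserve Haar measure (N8-INNER brick (4) READ-G, part I; Rogawski 1990 §3.1, §4.1, §4.3; Shelstad 1979 §4)

Topic `NumberTheory/Rogawski1990`; namespaces `Literature.MeasureTheory.Group` (§0, generic) and `Literature.NumberTheory.Automorphic.UnitaryGroup` (§1–§2a).  THEOREMS ONLY (no `def`,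
no instance, no notation, no axiom, no named fact, no `sorry`).  Cell `pub/hodgecm-mathlib`, crux H413 (`stmt-HodgeConjecture-24833`), F0∕P3c road «N8-INNER» (LEAD T14-4; row 2 `stub_N8`,
archimedean INNER transfer `G′_∞ → G_∞`), brick (4) «READ-G» of the N8-ROAD-CENSUS v0 fd90e2d340c810dd §2∕§5 (LH2-plan (g1) DEAL #1 2026-09-02T15:34:48Z; holder LH7-p01 (g7); ref5 R-725 «=»);
SIGSHEET `F0/P3c/LH7/LH7-p01/g7/SIGSHEET-N8-brick4-ReadG.v1.LH7p01g7.md` d6e741fda879bbc7.  PART I of two (part II `ArchStableSideChartReadG`: the frame mass is slot-coherent and the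
READ identity).  Count-neutral.

THE MATHEMATICS.  House frame `G′_∞ = U(diag α)(L⁺ ⊗ ℝ)`, `α_i ≠ 0`, `c(α_i) = α_i`; an admissible chart `S ⊆ splitChartPlaces L α`, `c ∈ RegG S`, `γ′ = gprimeTorus α S c` (regular).
* §0 (generic) **`map_eq_self_of_iterate_eq`**: a continuous automorphism `ψ` of a locally compact group with `ψ^[n] = id`, `n ≥ 1`, preserves every Haar measure (`ψ_* t = c • t`,
  `t = cⁿ • t` ⇒ `c = 1`; ★ (β) `map_eq_self_of_involutive` is `n = 2`); **`map_symm_eq_map_symm_of_transport`**: two presentations `sc₀ : T ≃ Z₀`, `sc : T ≃ Z₁` and `e : Z₀ ≃ₜ* Z₁`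
  carrying a Haar `t₀ ↦ t₁` with `sc⁻¹ ∘ e ∘ sc₀` of finite order ⇒ `t₁` and `t₀` agree on `T`.
* §1 (UNIQ-G′) **`setOf_isStablyConj_out_eq_image_slotPerm`**: the `G′_∞`-classes inside the stable class of `γ′` (★ `IsStablyConj (conjMixed) (archFormOf)`: `GL₃(L ⊗ ℝ)`-conjugacy) are
  exactly the classes of `γ′_ρ = gprimeTorus α S (slotPerm ρ c)`, `ρ ∈ partnerPerms S` — «⊇» both are norm partners of the `H`-chart point `endoTorus S c` (★
  `isArchNormPair_endoTorus_gprimeTorus_perm`, ★ `Corresponds.isStablyConj_right`); «⊆» a class stably conjugate to `γ′` is a norm partner of `endoTorus S c` (★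
  `Corresponds.of_isStablyConj_right`), hence a slot-permuted chart class by ★ ED. 2 §3 `forall_conjClasses_eq_mk_gprimeTorus_slotPerm`.  With ★ P3's constant fibre count
  (`2` at an indefinite compact place, `6` at a definite one, `1` at a chart place): **`finsum_mem_setOf_isStablyConj_out_eq_partnerWeight_mul_sum`** — the stable class sum of any class
  function is `partnerWeight L α S ·` its slot-label sum.
* §2a **`exists_forall_conj_gprimeTorus_eq_slotPerm`**: for `ρ ∈ partnerPerms S` ONE `y ∈ GL₃(L ⊗ ℝ)` with `y · gprimeTorus α S c₀ · y⁻¹ = gprimeTorus α S (slotPerm ρ c₀)` for EVERY `c₀` (place-wise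
  the re-indexed permutation matrix, ★ `swapMatrix_mul_coe_gprimeCptGL` with unit weights; `1` at the chart places; glued through ★ `GLnMixedPiEquiv`); `S₃` has exponent `6`
  (`slotPerms_pow_six`).
HONEST LABEL: HC_CM is proved only modulo the 7 printed citations (2 remaining: hLiu418 = `stmt-HodgeConjecture-24832`, h413 = `stmt-HodgeConjecture-24833`) until rung 0 closes;
count-neutral until (Sh)′ is ★ and ED. 43 re-keys 27456 6 → 5.

## References
* [Rogawski1990] J. D. Rogawski, *Automorphic Representations of Unitary Groups in Three Variables*, Ann. of Math. Stud. 123 (1990), §4.1 (4.1.1) p. 39 (stable orbital integral =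
  sum over the classes in the stable class), §4.3 (4.3.1) pp. 43–44 (compatible measures on the tori of a stable class), §14.2 (14.2.1) p. 232, §1.7 p. 6, §3.1 p. 19, §3.6 p. 31, §8.2 p. 122.
* [Shelstad1979] D. Shelstad, *Characters and inner forms of a quasi-split group over ℝ*, Compositio Math. 39 (1979), §4 pp. 20–23 (`dt` transported along stable conjugacy; `R_T`,
  `Ψ^T_f`; Lemma 4.2).
* [Knapp1986] A. W. Knapp, *Representation Theory of Semisimple Groups* (1986), Ch. V §3 (Cartan subgroups; Weyl group action by permutation matrices).
* [DeitmarEchterhoff2014] A. Deitmar, S. Echterhoff, *Principles of Harmonic Analysis*, 2nd ed. (2014), Thm. 1.5.3.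
* [Folland1995] G. B. Folland, *A Course in Abstract Harmonic Analysis* (1995), §2.2 (uniqueness of Haar measure; automorphisms act by a modulus).
-/

set_option autoImplicit false

noncomputable section

open MeasureTheory MeasureTheory.Measure NumberField NumberField.InfinitePlace Matrix Complex Topology
open Literature.MeasureTheory.Group
open scoped MatrixGroups Matrix Classical NNReal ENNReal

/-! ## §0 (generic) A continuous automorphism of finite order preserves every Haar measure -/

namespace Literature.MeasureTheory.Group

section FiniteOrder

variable {T : Type*} [Group T] [TopologicalSpace T] [IsTopologicalGroup T] [LocallyCompactSpace T] [SecondCountableTopology T]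
  [MeasurableSpace T] [BorelSpace T]

/-- **A continuous automorphism `ψ` with `ψ^[n] = id` (`n ≥ 1`) preserves every Haar measure**: `ψ_* t` is a Haar measure, hence `c • t`; iterating, `t = cⁿ • t`, so
`cⁿ = 1` and `c = 1` (the modulus of a finite-order automorphism is trivial).  ★ (β) `map_eq_self_of_involutive` is the case `n = 2`. [cite: Folland1995, §2.2] -/
theorem map_eq_self_of_iterate_eq (ψ : T ≃* T) (hψ : Continuous ψ) (hψs : Continuous ψ.symm) {n : ℕ} (hn : n ≠ 0) (hiter : ∀ x, (ψ : T → T)^[n] x = x)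
    (t : Measure T) [t.IsHaarMeasure] : Measure.map ψ t = t := by
  haveI : (Measure.map ψ t).IsHaarMeasure := ψ.isHaarMeasure_map t hψ hψs
  set c : ℝ≥0 := haarScalarFactor (Measure.map ψ t) t with hc
  have h1 : Measure.map ψ t = c • t := isMulLeftInvariant_eq_smul _ _
  -- `(ψ_*)^k t = c^k • t`
  have hk : ∀ k : ℕ, Measure.map ((ψ : T → T)^[k]) t = (c ^ k) • t := by
    intro k
    induction k with
    | zero => rw [Function.iterate_zero, Measure.map_id, pow_zero, one_smul]
    | succ k ih =>
        rw [Function.iterate_succ', ← Measure.map_map hψ.measurable (hψ.measurable.iterate k), ih, Measure.map_smul, h1, smul_smul, pow_succ]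
  have hid : ((ψ : T → T)^[n]) = id := funext hiter
  have h3 : t = (c ^ n) • t := by
    have h := hk n
    rwa [hid, Measure.map_id] at h
  -- evaluate on a positive compact
  obtain ⟨K⟩ := (inferInstance : Nonempty (TopologicalSpace.PositiveCompacts T))
  have hKpos : 0 < t K := measure_pos_of_nonempty_interior t K.interior_nonempty
  have hKfin : t K < ⊤ := K.isCompact.measure_lt_top
  have h4 : ((c ^ n : ℝ≥0) : ℝ≥0∞) * t K = 1 * t K := by
    have := congrArg (fun μ : Measure T => μ K) h3
    simp only [Measure.smul_apply, ENNReal.smul_def, smul_eq_mul] at this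
    rw [one_mul]; exact this.symm
  have h5 : ((c ^ n : ℝ≥0) : ℝ≥0∞) = 1 := (ENNReal.mul_left_inj hKpos.ne' hKfin.ne).mp h4
  have h6 : c ^ n = 1 := by exact_mod_cast h5
  have h7 : c = 1 := (pow_eq_one_iff.mp h6).resolve_right hn
  rw [h1, h7, one_smul]

/-- **ABSTRACT TRANSPORT.**  A group `TS` with two presentations `sc₀ : TS ≃* Z₀`, `sc : TS ≃* Z₁` and an isomorphism `e : Z₀ ≃ₜ* Z₁` carrying `t₀ ↦ t₁`; if `t₀` is a Haar measure and
the composite `sc⁻¹ ∘ e ∘ sc₀ : TS → TS` has FINITE ORDER, then `t₁` and `t₀` agree on `TS` (§0 `map_eq_self_of_iterate_eq`).  Small types on purpose: the frame instance (§2c) only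
supplies the hypotheses (cf. ★ `map_symm_eq_map_symm_of_transport_chain`, the involutive 5-object version). [cite: Folland1995, §2.2] [cite: Rogawski1990, §4.3 (4.3.1) p. 43] -/
theorem map_symm_eq_map_symm_of_transport {TS Z₀ Z₁ : Type*}
    [Group TS] [TopologicalSpace TS] [IsTopologicalGroup TS] [LocallyCompactSpace TS] [SecondCountableTopology TS] [MeasurableSpace TS] [BorelSpace TS]
    [Group Z₀] [TopologicalSpace Z₀] [IsTopologicalGroup Z₀] [MeasurableSpace Z₀] [BorelSpace Z₀]
    [Group Z₁] [TopologicalSpace Z₁] [MeasurableSpace Z₁] [BorelSpace Z₁]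
    (sc₀ : TS ≃* Z₀) (hsc₀ : Continuous sc₀) (hsc₀s : Continuous sc₀.symm)
    (sc : TS ≃* Z₁) (hsc : Continuous sc) (hscs : Continuous sc.symm)
    (e : Z₀ ≃ₜ* Z₁) (t₀ : Measure Z₀) [t₀.IsHaarMeasure] (t₁ : Measure Z₁) (he : Measure.map ⇑e t₀ = t₁)
    {n : ℕ} (hn : n ≠ 0) (hiter : ∀ x, (fun x => sc.symm (e (sc₀ x)))^[n] x = x) :
    Measure.map ⇑sc.symm t₁ = Measure.map ⇑sc₀.symm t₀ := by
  have me : Measurable ⇑e := e.continuous.measurable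
  let Ψ : TS ≃* TS := sc₀.trans (e.toMulEquiv.trans sc.symm)
  have hΨcoe : ⇑Ψ = fun x => sc.symm (e (sc₀ x)) := rfl
  have hΨc : Continuous Ψ := by rw [hΨcoe]; exact hscs.comp (e.continuous.comp hsc₀)
  have hΨsc : Continuous Ψ.symm := by
    show Continuous (fun x => sc₀.symm (e.symm (sc x)))
    exact hsc₀s.comp (e.symm.continuous.comp hsc)
  have hsymm₀ : (⇑sc₀ ∘ ⇑sc₀.symm) = id := funext fun x => sc₀.apply_symm_apply x
  have hμ : Measure.map ⇑sc₀ (Measure.map ⇑sc₀.symm t₀) = t₀ := by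
    rw [Measure.map_map hsc₀.measurable hsc₀s.measurable, hsymm₀, Measure.map_id]
  haveI : (Measure.map ⇑sc₀.symm t₀).IsHaarMeasure := sc₀.symm.isHaarMeasure_map t₀ hsc₀s hsc₀
  have key := map_eq_self_of_iterate_eq Ψ hΨc hΨsc hn (by rw [hΨcoe]; exact hiter) (Measure.map ⇑sc₀.symm t₀)
  calc Measure.map ⇑sc.symm t₁
      = Measure.map ⇑sc.symm (Measure.map ⇑e (Measure.map ⇑sc₀ (Measure.map ⇑sc₀.symm t₀))) := by rw [hμ, he]
    _ = Measure.map ⇑Ψ (Measure.map ⇑sc₀.symm t₀) := by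
        rw [Measure.map_map me hsc₀.measurable, Measure.map_map hscs.measurable (me.comp hsc₀.measurable), hΨcoe]
        rfl
    _ = Measure.map ⇑sc₀.symm t₀ := key

end FiniteOrder

end Literature.MeasureTheory.Group

/-! ## §1 (UNIQ-G′) The classes inside the stable class of a regular chart point are the slot-permuted chart classes -/

namespace Literature.NumberTheory.Automorphic.UnitaryGroup

open Literature.NumberTheory.Rogawski1990 Literature.NumberTheory.Automorphic.ArchCartan

section Uniq

/-- `slotPerm ρ c` is `w ↦ c w ∘ ρ w` (definitional; the spelling of ★ `isArchNormPair_endoTorus_gprimeTorus_perm`). [cite: Shelstad1979, Lemma 4.2 p. 23] -/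
theorem slotPerm_eq_comp {W : Type*} (ρ : W → Equiv.Perm (Fin 3)) (c : W → Fin 3 → ℝ) : slotPerm ρ c = fun w => c w ∘ ρ w := rfl

/-- `x ∼ out ⟦x⟧` in any monoid. [folklore] -/
private theorem isConj_out_conjClassesMk {G : Type*} [Monoid G] (x : G) : IsConj x (Quotient.out (ConjClasses.mk x)) := by
  have h : ConjClasses.mk (Quotient.out (ConjClasses.mk x)) = ConjClasses.mk x := Quotient.out_eq _
  exact ConjClasses.mk_eq_mk_iff_isConj.mp h.symm

variable (L : Type) [Field L] [NumberField L] [IsCMField L] (α : Fin 3 → L) (S : Finset {w : InfinitePlace L // IsComplex w})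

/-- **Slot-permuted chart points are STABLY conjugate**: for `S ⊆ splitChartPlaces` and `ρ ∈ partnerPerms S`, `gprimeTorus α S c ∼_st gprimeTorus α S (slotPerm ρ c)` in
`G′_∞ = U(diag α)(L⁺ ⊗ ℝ)` (both are norm partners of the `H`-chart point `endoTorus S c`, ★ `isArchNormPair_endoTorus_gprimeTorus_perm`; ★ `Corresponds.isStablyConj_right`).
[cite: Rogawski1990, §3.1 p. 19; §4.3 p. 42] [cite: Shelstad1979, Lemma 4.2 p. 23] -/
theorem isStablyConj_gprimeTorus_slotPerm (hS : ∀ w, w ∈ S → w ∈ splitChartPlaces L α)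
    {ρ : {w : InfinitePlace L // IsComplex w} → Equiv.Perm (Fin 3)} (hρ : ρ ∈ partnerPerms S) (c : {w : InfinitePlace L // IsComplex w} → Fin 3 → ℝ) :
    IsStablyConj (conjMixed (↥(maximalRealSubfield L)) L (IsCMField.complexConj L)) (archFormOf L 3 (Matrix.diagonal α))
      (gprimeTorus L α S c) (gprimeTorus L α S (slotPerm ρ c)) := by
  have h₁ := (isArchNormPair_iff L (Matrix.diagonal α) (endoTorus L S c) (gprimeTorus L α S c)).1 (isArchNormPair_endoTorus_gprimeTorus L α S c hS)
  have h₂ := (isArchNormPair_iff L (Matrix.diagonal α) (endoTorus L S c) (gprimeTorus L α S fun w => c w ∘ ρ w)).1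
    (isArchNormPair_endoTorus_gprimeTorus_perm L α S c hS ρ fun w hw => (mem_partnerPerms_iff S ρ).1 hρ w hw)
  rw [slotPerm_eq_comp]
  exact h₁.isStablyConj_right h₂

/-- The class of a slot-permuted chart point lies in the stable class of the chart point (`Quotient.out` form). [cite: Rogawski1990, §4.1 p. 39] -/
theorem isStablyConj_gprimeTorus_out_mk_slotPerm (hS : ∀ w, w ∈ S → w ∈ splitChartPlaces L α)
    {ρ : {w : InfinitePlace L // IsComplex w} → Equiv.Perm (Fin 3)} (hρ : ρ ∈ partnerPerms S) (c : {w : InfinitePlace L // IsComplex w} → Fin 3 → ℝ) :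
    IsStablyConj (conjMixed (↥(maximalRealSubfield L)) L (IsCMField.complexConj L)) (archFormOf L 3 (Matrix.diagonal α))
      (gprimeTorus L α S c) (Quotient.out (ConjClasses.mk (gprimeTorus L α S (slotPerm ρ c)))) := by
  exact (isStablyConj_gprimeTorus_slotPerm L α S hS hρ c).trans (isStablyConj_of_isConj (isConj_out_conjClassesMk _))

/-- **A class STABLY conjugate to a regular chart point is a slot-permuted chart class** (★ ED. 2 §3 through the `H`-chart partner `endoTorus S c`).
[cite: Rogawski1990, §4.1 p. 39; §3.6 p. 31] [cite: Shelstad1979, §4 p. 23] -/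
theorem exists_slotPerm_mk_eq_of_isStablyConj_out (hα : ∀ i, α i ≠ 0) (hherm : ∀ i, (IsCMField.complexConj L (α i) : L) = α i)
    (hS : ∀ w, w ∈ S → w ∈ splitChartPlaces L α) {c : {w : InfinitePlace L // IsComplex w} → Fin 3 → ℝ} (hc : c ∈ ArchCartan.RegG S)
    (c' : ConjClasses ↥(arch (↥(maximalRealSubfield L)) L (IsCMField.complexConj L) 3 (Matrix.diagonal α)))
    (h : IsStablyConj (conjMixed (↥(maximalRealSubfield L)) L (IsCMField.complexConj L)) (archFormOf L 3 (Matrix.diagonal α)) (gprimeTorus L α S c) (Quotient.out c')) :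
    ∃ ρ ∈ partnerPerms S, c' = ConjClasses.mk (gprimeTorus L α S (slotPerm ρ c)) := by
  have hreal := im_embedding_diagonal_eq_zero L 3 α hherm
  have hnp : IsArchNormPair L (Matrix.diagonal α) (endoTorus L S c) (Quotient.out c') := by
    rw [isArchNormPair_iff]
    exact ((isArchNormPair_iff L (Matrix.diagonal α) (endoTorus L S c) (gprimeTorus L α S c)).1 (isArchNormPair_endoTorus_gprimeTorus L α S c hS)).of_isStablyConj_right h
  exact forall_conjClasses_eq_mk_gprimeTorus_slotPerm L α S c hα hreal (fun w hw => hS w hw) hc c' hnp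

/-- **UNIQ-G′ — THE `hidx` OF READ-G′**: for `c ∈ RegG S`, `S ⊆ splitChartPlaces`, the `G′_∞`-classes inside the STABLE class of `gprimeTorus α S c` are exactly the slot-permuted
chart classes `⟦gprimeTorus α S (slotPerm ρ c)⟧`, `ρ ∈ partnerPerms S` (twin of ★ UNIQ-H `setOf_isArchStablyConjH_out_eq_image_flipSet`). [cite: Rogawski1990, §4.1 (4.1.1) p. 39; §3.6 p. 31]
[cite: Shelstad1979, §4 pp. 22–23, Lemma 4.2] -/
theorem setOf_isStablyConj_out_eq_image_slotPerm (hα : ∀ i, α i ≠ 0) (hherm : ∀ i, (IsCMField.complexConj L (α i) : L) = α i)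
    (hS : ∀ w, w ∈ S → w ∈ splitChartPlaces L α) {c : {w : InfinitePlace L // IsComplex w} → Fin 3 → ℝ} (hc : c ∈ ArchCartan.RegG S) :
    {c' : ConjClasses ↥(arch (↥(maximalRealSubfield L)) L (IsCMField.complexConj L) 3 (Matrix.diagonal α)) |
        IsStablyConj (conjMixed (↥(maximalRealSubfield L)) L (IsCMField.complexConj L)) (archFormOf L 3 (Matrix.diagonal α)) (gprimeTorus L α S c) (Quotient.out c')} =
      (fun ρ : {w : InfinitePlace L // IsComplex w} → Equiv.Perm (Fin 3) => ConjClasses.mk (gprimeTorus L α S (slotPerm ρ c))) '' ↑(partnerPerms S) := by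
  ext c₁
  constructor
  · intro h
    obtain ⟨ρ, hρ, h1⟩ := exists_slotPerm_mk_eq_of_isStablyConj_out L α S hα hherm hS hc c₁ h
    exact ⟨ρ, Finset.mem_coe.2 hρ, h1.symm⟩
  · rintro ⟨ρ, hρ, rfl⟩
    exact isStablyConj_gprimeTorus_out_mk_slotPerm L α S hS (Finset.mem_coe.1 hρ) c

/-- **The stable class sum as a slot-label sum**: for every function `F` on the classes of `G′_∞`,
`Σᶠ_{c′ ∈ st(γ′)} F c′ = partnerWeight L α S · Σ_{ρ ∈ partnerPerms S} F ⟦gprimeTorus α S (slotPerm ρ c)⟧` (§1 + ★ P3 `sum_image_eq_partnerWeight_mul_sum_partnerPerms`: each class is hit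
`2` ∕ `6` ∕ `1` times). [cite: Rogawski1990, §4.1 (4.1.1) p. 39; §4.3 (4.3.1) p. 43] [cite: Shelstad1979, Lemma 4.2 p. 23] -/
theorem finsum_mem_setOf_isStablyConj_out_eq_partnerWeight_mul_sum (hα : ∀ i, α i ≠ 0) (hherm : ∀ i, (IsCMField.complexConj L (α i) : L) = α i)
    (hS : ∀ w, w ∈ S → w ∈ splitChartPlaces L α) {c : {w : InfinitePlace L // IsComplex w} → Fin 3 → ℝ} (hc : c ∈ ArchCartan.RegG S)
    (F : ConjClasses ↥(arch (↥(maximalRealSubfield L)) L (IsCMField.complexConj L) 3 (Matrix.diagonal α)) → ℂ) :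
    ∑ᶠ c' ∈ {c' : ConjClasses ↥(arch (↥(maximalRealSubfield L)) L (IsCMField.complexConj L) 3 (Matrix.diagonal α)) |
        IsStablyConj (conjMixed (↥(maximalRealSubfield L)) L (IsCMField.complexConj L)) (archFormOf L 3 (Matrix.diagonal α)) (gprimeTorus L α S c) (Quotient.out c')}, F c' =
      partnerWeight L α S * ∑ ρ ∈ partnerPerms S, F (ConjClasses.mk (gprimeTorus L α S (slotPerm ρ c))) := by
  rw [setOf_isStablyConj_out_eq_image_slotPerm L α S hα hherm hS hc, ← Finset.coe_image, finsum_mem_coe_finset]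
  exact sum_image_eq_partnerWeight_mul_sum_partnerPerms L α hα hherm ((ArchCartan.mem_regG_iff S c).1 hc).1 F

end Uniq

/-! ## §2a One element of `GL₃(L ⊗ ℝ)` permutes the slots of the whole chart -/

section SlotConj

/-- **`S₃` has exponent `6`**: `σ ^ 6 = 1` for every permutation of three letters (`orderOf σ ∣ |S₃| = 6`; `S₃` = the Weyl group of the compact Cartan of `U(3)` ∕ `U(2,1)` acting
on the chart slots). [folklore] [cite: Knapp1986, Ch. V §3] [cite: Shelstad1979, Lemma 4.2 p. 23] -/
theorem perm_fin_three_pow_six (σ : Equiv.Perm (Fin 3)) : σ ^ 6 = 1 := by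
  have h : Fintype.card (Equiv.Perm (Fin 3)) = 6 := by rw [Fintype.card_perm, Fintype.card_fin]; rfl
  rw [← h]
  exact pow_card_eq_one

/-- Place-families of slot permutations have exponent `6`: `ρ ^ 6 = 1` (place by place `S₃`). [folklore] [cite: Knapp1986, Ch. V §3] [cite: Shelstad1979, Lemma 4.2 p. 23] -/
theorem slotPerms_pow_six {W : Type*} (ρ : W → Equiv.Perm (Fin 3)) : ρ ^ 6 = 1 :=
  funext fun w => by rw [Pi.pow_apply, Pi.one_apply, perm_fin_three_pow_six]

/-- **COMPACT PLACE, SIMULTANEOUS CONJUGATION**: for slot permutations `τ` (the frame's line order) and `σ`, ONE `u ∈ GL₃(ℂ)` (the re-indexed permutation matrix of `σ`, ★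
`swapMatrix_mul_coe_gprimeCptGL` with unit weights) conjugates `gprimeCptGL τ c` to `gprimeCptGL τ (c ∘ σ)` for EVERY `c`. [cite: Rogawski1990, §3.6 p. 31; §3.1 p. 19] [cite: Knapp1986, Ch. V §3] -/
theorem exists_forall_conj_gprimeCptGL_eq_comp (τ σ : Equiv.Perm (Fin 3)) :
    ∃ u : GL (Fin 3) ℂ, ∀ c : Fin 3 → ℝ, u * gprimeCptGL τ c * u⁻¹ = gprimeCptGL τ (c ∘ σ) := by
  set N : Matrix (Fin 3) (Fin 3) ℂ := (Matrix.diagonal (fun _ : Fin 3 => (1 : ℂ)) * (σ.toPEquiv.toMatrix : Matrix (Fin 3) (Fin 3) ℂ)).submatrix τ.symm τ.symm with hN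
  have hdet : N.det ≠ 0 := by
    rw [hN, Matrix.det_submatrix_equiv_self, Matrix.diagonal_one, Matrix.one_mul, Matrix.det_permutation]
    exact Int.cast_ne_zero.2 (Units.ne_zero _)
  refine ⟨Matrix.GeneralLinearGroup.mkOfDetNeZero N hdet, fun c => ?_⟩
  rw [mul_inv_eq_iff_eq_mul]
  apply Units.ext
  rw [Units.val_mul, Units.val_mul, Matrix.GeneralLinearGroup.val_mkOfDetNeZero]
  exact swapMatrix_mul_coe_gprimeCptGL τ σ (fun _ => (1 : ℂ)) c

variable (L : Type) [Field L] [NumberField L] [IsCMField L] (α : Fin 3 → L) (S : Finset {w : InfinitePlace L // IsComplex w})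

omit [IsCMField L] in
/-- **PLACE BY PLACE**: for `ρ ∈ partnerPerms S`, at every place ONE `u_w ∈ GL₃(ℂ)` conjugates the chart component `gprimeBlock α w S c` to `gprimeBlock α w S (slotPerm ρ c)` for
EVERY `c` (`u_w = 1` at `w ∈ S`, where `ρ_w = 1`; the permutation matrix of §2a at `w ∉ S`). [cite: Rogawski1990, §3.6 p. 31] [cite: Shelstad1979, Lemma 4.2 p. 23] -/
theorem exists_forall_conj_gprimeBlock_eq_slotPerm {ρ : {w : InfinitePlace L // IsComplex w} → Equiv.Perm (Fin 3)} (hρ : ρ ∈ partnerPerms S)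
    (w : {w : InfinitePlace L // IsComplex w}) :
    ∃ u : GL (Fin 3) ℂ, ∀ c : {w : InfinitePlace L // IsComplex w} → Fin 3 → ℝ,
      u * ((gprimeBlock L α w S c : ↥(archLocal L 3 (Matrix.diagonal α) w)) : GL (Fin 3) ℂ) * u⁻¹ =
        ((gprimeBlock L α w S (slotPerm ρ c) : ↥(archLocal L 3 (Matrix.diagonal α) w)) : GL (Fin 3) ℂ) := by
  by_cases hw : w ∈ S
  · refine ⟨1, fun c => ?_⟩
    rw [one_mul, inv_one, mul_one, gprimeBlock_congr_apply L α (slotPerm_apply_of_mem hρ hw c).symm]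
  · obtain ⟨u, hu⟩ := exists_forall_conj_gprimeCptGL_eq_comp (lineOf (formSign L α w)) (ρ w)
    refine ⟨u, fun c => ?_⟩
    rw [coe_gprimeBlock_of_not_mem L α c hw, coe_gprimeBlock_of_not_mem L α (slotPerm ρ c) hw]
    exact hu (c w)

/-- **SIMULTANEOUS SLOT CONJUGATION IN `GL₃(L ⊗ ℝ)`**: for `ρ ∈ partnerPerms S` there is ONE `y ∈ GL₃(L ⊗ ℝ)` with `y · gprimeTorus α S c · y⁻¹ = gprimeTorus α S (slotPerm ρ c)` for EVERY `c`
(glue the place conjugators through ★ `GLnMixedPiEquiv`; the mirror of ★ `exists_forall_conj_endoEmbArch_endoTorus_eq_flipSet`). [cite: Rogawski1990, §3.1 p. 19; §4.3 pp. 43–44]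
[cite: Shelstad1979, §4 pp. 22–23] -/
theorem exists_forall_conj_gprimeTorus_eq_slotPerm {ρ : {w : InfinitePlace L // IsComplex w} → Equiv.Perm (Fin 3)} (hρ : ρ ∈ partnerPerms S) :
    ∃ y : GL (Fin 3) (mixedEmbedding.mixedSpace L), ∀ c : {w : InfinitePlace L // IsComplex w} → Fin 3 → ℝ,
      y * ((gprimeTorus L α S c).val : GL (Fin 3) (mixedEmbedding.mixedSpace L)) * y⁻¹ =
        ((gprimeTorus L α S (slotPerm ρ c)).val : GL (Fin 3) (mixedEmbedding.mixedSpace L)) := by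
  choose u hu using exists_forall_conj_gprimeBlock_eq_slotPerm L α S hρ
  refine ⟨(GLnMixedPiEquiv (↥(maximalRealSubfield L)) L (IsCMField.complexConj L) 3 (IsCMField.complexConj_ne_one L) (complexConj_smul_infinitePlace L)).symm u,
    fun c => ?_⟩
  apply (GLnMixedPiEquiv (↥(maximalRealSubfield L)) L (IsCMField.complexConj L) 3 (IsCMField.complexConj_ne_one L) (complexConj_smul_infinitePlace L)).injective
  rw [map_mul, map_mul, map_inv, ContinuousMulEquiv.apply_symm_apply]
  funext w
  rw [Pi.mul_apply, Pi.mul_apply, Pi.inv_apply, GLnMixedPiEquiv_apply, GLnMixedPiEquiv_apply, ← coe_archPiEquivCM_apply, ← coe_archPiEquivCM_apply,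
    archPiEquivCM_gprimeTorus, archPiEquivCM_gprimeTorus]
  exact hu w c

end SlotConj

end Literature.NumberTheory.Automorphic.UnitaryGroup

end
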